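import Literature.MathematicalPhysics.QuantumFieldTheory.Dimock2011to13.MayerExpansion

/-!
# Dimock, *The renormalization group according to Balaban* I, Appendix B, proof of THEOREM `\label{cluster}`, STEP 1
# (second half, TeX L3234–3279): the bound on the cluster activity `|K(Y,Φ)| ≤ 𝒪(1) H₀ e^{−(κ−κ₀−2) d_M(Y)}` — from
# `|e^H − 1| ≤ 2|H|`, the extraction of `e^{−(κ−κ₀)(d_M(Y) − (n−1))}` via (clams), the resummation over SETS of
# sub-polymers and the closing arithmetic — PROVED over an abstract family of covers (Mathlib only)

**Citation header (reproduction of PUBLISHED work; template of the Bałaban lattice Yang–Mills cell).**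
J. Dimock, *The renormalization group according to Balaban I. Small fields*, Rev. Math. Phys. **25** (2013) 1330010
(= arXiv:1108.1335v2) [Dimock2013], Appendix B "cluster expansion", THEOREM `\label{cluster}` (#27) L3178–3194, proof step 1
L3204–3279: the Mayer expansion L3204–3225 (kernel in this directory as `MayerExpansion`), the bound `|e^H − 1| ≤ 2H`
L3234–3242, (clams) L3247–3256, the extraction and resummation L3259–3270, the closing arithmetic L3271–3279; Appendix A
(sudsy) L3144 and (ninety) L1345–1346.  TeX line numbers refer to the arXiv source held by the cell
(`inputs/files/dimock/src/1108.1335/1108.1335.tex`); every quotation below was read there this session.  Dimock's papers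
are published and refereed and are the cell's TEMPLATE, not manuscripts under audit; no quantity of the Bałaban series
is touched.

**What the paper prints (verbatim).**  L3234–3242: *"If H_0 ≤ log 2 then on the support of μ |e^{H(X,Φ)} − 1| ≤ 2H(X,Φ) ≤
2H_0e^{−κd_M(X)} and so |K(Y,Φ)| ≤ Σ_{n=1}^∞ (1/n!) Σ_{(X_1,⋯,X_n): ∪_iX_i = Y} Π_{i=1}^n 2H_0e^{−κd_M(X_i)}"*.  (clams)
L3247–3250: *"if ∪_{i=1}^n X_i = Y as above, then Md_M(Y) ≤ Σ_{i=1}^n Md_M(X_i) + M(n−1)"*.  L3259–3279: *"We use this to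
extract a factor exp(−(κ−κ_0)(d_M(Y) − (n−1))). Dropping all conditions on the X_i except X_i ⊂ Y we have |K(Y,Φ)| ≤
e^{−(κ−κ_0)d_M(Y)} Σ_{n=1}^∞ (1/n!) e^{(κ−κ_0)n} Σ_{(X_1,⋯,X_n)⊂Y^n} Π_{i=1}^n 2H_0e^{−κ_0d_M(X_i)} ≤ e^{−(κ−κ_0)d_M(Y)} Σ_{n=1}^∞
(1/n!)(e^{κ−κ_0} Σ_{X⊂Y} 2H_0e^{−κ_0d_M(X)})^n ≤ e^{−(κ−κ_0)d_M(Y)} Σ_{n=1}^∞ (1/n!)(2H_0K_0e^{κ−κ_0}|Y|_M)^n ≤ e^{−(κ−κ_0)d_M(Y)}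
2H_0K_0e^{κ−κ_0}|Y|_M exp(2H_0K_0e^{κ−κ_0}|Y|_M)  Now |Y|_M ≤ 3^d(1 + d_M(Y)) ≤ κ_0(1 + d_M(Y)). Furthermore we assume c_0 is
small enough so that 2c_0K_0κ_0e^{κ−κ_0} ≤ 1. (So c_0 does depend on κ.) Then the exponent is bounded by 𝒪(1)e^{d_M(Y)} and
downstairs 2H_0K_0e^{κ−κ_0}|Y|_M is bounded by 𝒪(1)H_0e^{d_M(Y)}. Altogether then on the support of μ |K(Y,Φ)| ≤ 𝒪(1) H_0
e^{−(κ−κ_0−2)d_M(Y)}"*.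

**What is reproduced here (kernel-checked, zero `sorry`; Mathlib only).**  ABSTRACT DATA: polymers `X : P`, a finite set
`Q` of them (print: the polymers `X ⊂ Y`), a finite family `TS` of nonempty sub-collections `T ⊆ Q` (print: the
connected covers `{X_i}` of `Y`, `∪X_i = Y` — the index set of `K(Y)`), a size `d X ≥ 0` (print: `d_M(X)`), a number
`dY` (print: `d_M(Y)`), weights `a X` in `ℝ` or `ℂ` (print: `e^{H(X,Φ)} − 1`), and the two geometric inputs as
HYPOTHESES: (clams) in the form `dY ≤ Σ_{X∈T} d X + c(|T| − 1)` for every `T ∈ TS` (print: `c = 1`; the cell's torus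
kernel G3 `TreeLengthTorusGeometry.ineq227_torusTreeLen` gives `c = 2`), and (sudsy) `Σ_{X∈Q} e^{−κ₀ d X} ≤ K₀·vY`
(print: `vY = |Y|_M`).
* §1 `norm_exp_sub_one_le_two_mul` — *"If H_0 ≤ log 2 then |e^{H} − 1| ≤ 2H"* (complex `H`, from Mathlib's bound on
  `|z| ≤ 1 ⊇ |z| ≤ log 2`); `weight_le` (`|a X| ≤ 2H₀e^{−κ d X}` from `|H(X)| ≤ H₀e^{−κd X}`, `H₀ ≤ log 2`).
* §2 THE EXTRACTION (L3259): **`prod_exp_le_extract`** — for `T` with (clams), `κ₀ ≤ κ`: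
  `Π_{X∈T} e^{−κ d X} ≤ e^{−(κ−κ₀)dY} · e^{−c(κ−κ₀)} · Π_{X∈T} (e^{c(κ−κ₀)} e^{−κ₀ d X})`.
* §3 THE RESUMMATION OVER SETS (reading (ii)): **`sum_prod_le_prod_one_add_sub_one`** (`Σ_{T∈TS} Π_{X∈T} w X ≤
  Π_{X∈Q}(1 + w X) − 1` for nonnegative `w` and nonempty `T ⊆ Q`), `prod_one_add_sub_one_le` (`Π(1+w) − 1 ≤ W e^{W}`,
  `W = Σ w` — the print's `Σ_{n≥1}(1/n!)(⋯)^n ≤ x e^x`).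
* §4 THE ASSEMBLED BOUND: **`norm_clusterSum_le`** — `‖Σ_{T∈TS} Π_{X∈T} a X‖ ≤ e^{−(κ−κ₀)dY} e^{−c(κ−κ₀)} · W e^{W}` with
  `W = 2H₀e^{c(κ−κ₀)} Σ_{X∈Q} e^{−κ₀ d X}` (the four displayed lines L3262–3268, sets instead of ordered tuples).
* §5 THE CLOSING ARITHMETIC (L3271–3279): **`norm_clusterSum_le_final`** — with (sudsy) `Σ_{X∈Q}e^{−κ₀d X} ≤ K₀ vY`,
  (ninety) `vY ≤ κ₀(1 + dY)`, `H₀ ≤ c₀` and the smallness `2c₀K₀κ₀e^{c(κ−κ₀)} ≤ 1`: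
  `‖Σ_{T∈TS}Π a‖ ≤ (2e·K₀κ₀) · H₀ · e^{−(κ−κ₀−2) dY}` — the printed `𝒪(1)H_0 e^{−(κ−κ_0−2)d_M(Y)}` with `𝒪(1) = 2eK₀κ₀`
  (the factor `e^{−c(κ−κ₀)} e^{c(κ−κ₀)}` cancelling).

**Readings (declared).**  (i) ABSTRACT COVERS: `TS`, `Q`, `d`, `dY`, `vY` are parameters; the instance is `TS = covers Y`,
`Q = {X ∈ Pol : X ⊆ Y}` of `MayerExpansion` with `d = d_M`, for which (clams) is the cell's kernel G3 (`+2` per member on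
the torus carrier, `+1` in print after the `M`-scaling) — in v1 the instantiation was by name; §6 (v1.1) imports `MayerExpansion`
and instantiates: **`norm_K_le`** bounds Dimock's `K(Y) = MayerExpansion.K supp Pol (T ↦ Π_{X∈T} a_X) Y` itself.  (ii) SETS, NOT ORDERED TUPLES: the print bounds `K(Y)` by `Σ_n (1/n!) Σ_{(X_1…X_n)}`;
for collections of DISTINCT polymers the sum over sets `T ⊆ Q` is exact and is bounded by `Π_{X∈Q}(1 + w_X) − 1 ≤ e^W − 1
≤ We^W`, the same final form as the print's `Σ_{n≥1}(1/n!)W^n ≤ We^W`.  (iii) CONSTANTS explicit: `𝒪(1) = 2eK₀κ₀`; the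
smallness is the printed `2c₀K₀κ₀e^{κ−κ₀} ≤ 1` with `e^{κ−κ₀} ↦ e^{c(κ−κ₀)}`.  (iv) `κ₀ ≥ 3^d` enters only through the
hypothesis `vY ≤ κ₀(1 + dY)` ((ninety) with `3^d ≤ κ₀`).

**What is NOT claimed.**  (clams), (sudsy), (ninety) — hypotheses (kernel elsewhere in the cell for the torus tree length:
G3, G5, G1); steps 2–3 of the proof (the exponentiation into `H^#`, (sunshine0)); THEOREM 27 itself; anything of B1–B16
(TEMPLATE.md §4.1 row «D1 §4.6» ↔ B12∕B13 — grade there; untouched).  NOT summit progress; NOT a statement about any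
Bałaban paper; NOT continuum; NOT Clay.  v1: NEW leaf, imports Mathlib only; v1.1: import switched to
`…Dimock2011to13.MayerExpansion` (this lineage; it imports Mathlib and the tree's `LatticeModels.ClusterExpansion`; no
cycle) and §6 appended, every v1 declaration byte-identical; sub-namespace `…Dimock2011to13.ClusterActivityBound`;
modifies nothing.  Unit `b2b-balaban-template` gen 32 (journal CLAIMs D1-CLUSTER-ACTIVITY-KERNEL (v1),
D1-CLUSTER-ACTIVITY-INSTANCE (v1.1)); cell records TEMPLATE.md §4.1 row «D1 §4.6», §15.2; GAPS C-tmpl32-4, C-tmpl32-9.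
-/

noncomputable section

open Finset Real
open scoped BigOperators

namespace Literature.MathematicalPhysics.QuantumFieldTheory.Dimock2011to13.ClusterActivityBound

variable {P : Type*}

/-! ## §1 `|e^H − 1| ≤ 2|H|` -/

/-- *"If H_0 ≤ log 2 then … |e^{H(X,Φ)} − 1| ≤ 2H(X,Φ)"* (L3234–3236): for complex `h` with `‖h‖ ≤ log 2` (indeed `≤ 1`),
`‖e^h − 1‖ ≤ 2‖h‖`. [cite: Dimock2013, App. B Theorem cluster, proof step 1 (arXiv:1108.1335v2 TeX L3234–3237)] -/
theorem norm_exp_sub_one_le_two_mul {h : ℂ} (hh : ‖h‖ ≤ Real.log 2) : ‖Complex.exp h - 1‖ ≤ 2 * ‖h‖ := by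
  have hlog : Real.log 2 ≤ 1 := by
    have := Real.log_two_lt_d9; linarith
  exact Complex.norm_exp_sub_one_le (hh.trans hlog)

/-- the weight bound: `|H(X)| ≤ H₀e^{−κd(X)}` with `H₀ ≤ log 2` (so that `|H(X)| ≤ log 2` as `d ≥ 0`, `κ ≥ 0`) gives
`|e^{H(X)} − 1| ≤ 2H₀e^{−κd(X)}` (L3236). [cite: Dimock2013, App. B Theorem cluster, proof step 1 (arXiv:1108.1335v2 TeX
L3234–3237)] -/
theorem weight_le {H : P → ℂ} {H₀ κ : ℝ} {d : P → ℝ} (hH₀ : H₀ ≤ Real.log 2) (hκ : 0 ≤ κ) (hd : ∀ X, 0 ≤ d X)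
    (hH : ∀ X, ‖H X‖ ≤ H₀ * Real.exp (-κ * d X)) (X : P) :
    ‖Complex.exp (H X) - 1‖ ≤ 2 * H₀ * Real.exp (-κ * d X) := by
  have hexp : Real.exp (-κ * d X) ≤ 1 := by
    rw [Real.exp_le_one_iff]; nlinarith [hd X]
  have hH0 : 0 ≤ H₀ := by
    have := (norm_nonneg _).trans (hH X)
    by_contra hneg
    have : H₀ * Real.exp (-κ * d X) < 0 := mul_neg_of_neg_of_pos (lt_of_not_ge hneg) (Real.exp_pos _)
    linarith
  have h1 : ‖H X‖ ≤ Real.log 2 :=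
    (hH X).trans ((mul_le_of_le_one_right hH0 hexp).trans hH₀)
  calc ‖Complex.exp (H X) - 1‖ ≤ 2 * ‖H X‖ := norm_exp_sub_one_le_two_mul h1
    _ ≤ 2 * (H₀ * Real.exp (-κ * d X)) := by linarith [hH X]
    _ = 2 * H₀ * Real.exp (-κ * d X) := by ring

/-! ## §2 The extraction of `e^{−(κ−κ₀)(d_M(Y) − (n−1))}` (L3259) -/

/-- **THE EXTRACTION**: if `d_M(Y) ≤ Σ_{X∈T} d(X) + c(|T| − 1)` ((clams)) and `κ₀ ≤ κ`, then `Π_{X∈T} e^{−κd(X)} ≤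
e^{−(κ−κ₀)d_M(Y)} e^{−c(κ−κ₀)} Π_{X∈T}(e^{c(κ−κ₀)}e^{−κ₀d(X)})` — *"We use this to extract a factor exp(−(κ−κ_0)(d_M(Y) −
(n−1)))"*. [cite: Dimock2013, App. B Theorem cluster, proof step 1 (arXiv:1108.1335v2 TeX L3247–3264)] -/
theorem prod_exp_le_extract (T : Finset P) {d : P → ℝ} {dY c κ κ₀ : ℝ} (hκ : κ₀ ≤ κ)
    (hclams : dY ≤ ∑ X ∈ T, d X + c * (T.card - 1)) :
    ∏ X ∈ T, Real.exp (-κ * d X) ≤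
      Real.exp (-(κ - κ₀) * dY) * Real.exp (-(c * (κ - κ₀))) *
        ∏ X ∈ T, (Real.exp (c * (κ - κ₀)) * Real.exp (-κ₀ * d X)) := by
  rw [Finset.prod_mul_distrib, Finset.prod_const, ← Real.exp_sum, ← Real.exp_sum]
  have hpow : Real.exp (c * (κ - κ₀)) ^ T.card = Real.exp (c * (κ - κ₀) * T.card) := by
    rw [← Real.exp_nat_mul]; ring_nf
  rw [hpow, ← Real.exp_add, ← Real.exp_add, ← Real.exp_add, Real.exp_le_exp]
  have hsum : ∑ X ∈ T, -κ * d X = -(κ - κ₀) * ∑ X ∈ T, d X + ∑ X ∈ T, -κ₀ * d X := by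
    rw [Finset.mul_sum, ← Finset.sum_add_distrib]
    exact Finset.sum_congr rfl fun X _ => by ring
  rw [hsum]
  have hk : 0 ≤ κ - κ₀ := by linarith
  nlinarith [mul_le_mul_of_nonneg_left hclams hk]

/-! ## §3 The resummation over sets of sub-polymers (L3260–3268) -/

/-- **SUMS OVER FAMILIES OF NONEMPTY SUB-COLLECTIONS**: for nonnegative `w` and a family `TS` of nonempty `T ⊆ Q`,
`Σ_{T∈TS} Π_{X∈T} w(X) ≤ Π_{X∈Q}(1 + w(X)) − 1` (*"Dropping all conditions on the X_i except X_i ⊂ Y"*; sets instead of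
ordered tuples, reading (ii)). [cite: Dimock2013, App. B Theorem cluster, proof step 1 (arXiv:1108.1335v2 TeX
L3259–3266)] -/
theorem sum_prod_le_prod_one_add_sub_one [DecidableEq P] {Q : Finset P} {TS : Finset (Finset P)} {w : P → ℝ}
    (hw : ∀ X ∈ Q, 0 ≤ w X) (hTS : ∀ T ∈ TS, T ⊆ Q ∧ T.Nonempty) :
    ∑ T ∈ TS, ∏ X ∈ T, w X ≤ ∏ X ∈ Q, (1 + w X) - 1 := by
  have hsub : TS ⊆ Q.powerset.erase ∅ := by
    intro T hT
    obtain ⟨h1, h2⟩ := hTS T hT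
    exact Finset.mem_erase.2 ⟨h2.ne_empty, Finset.mem_powerset.2 h1⟩
  have hnonneg : ∀ T ∈ Q.powerset.erase ∅, 0 ≤ ∏ X ∈ T, w X := fun T hT =>
    Finset.prod_nonneg fun X hX => hw X (Finset.mem_powerset.1 (Finset.mem_of_mem_erase hT) hX)
  calc ∑ T ∈ TS, ∏ X ∈ T, w X ≤ ∑ T ∈ Q.powerset.erase ∅, ∏ X ∈ T, w X :=
        Finset.sum_le_sum_of_subset_of_nonneg hsub fun T hT _ => hnonneg T hT
    _ = ∏ X ∈ Q, (1 + w X) - 1 := by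
        rw [Finset.prod_one_add, ← Finset.add_sum_erase _ _ (Finset.empty_mem_powerset Q)]
        simp

/-- `Π_{X∈Q}(1 + w(X)) − 1 ≤ W e^{W}` with `W = Σ_{X∈Q} w(X)`, `w ≥ 0` (the print's `Σ_{n≥1}(1/n!)W^n ≤ We^W`, L3267–3268).
[cite: Dimock2013, App. B Theorem cluster, proof step 1 (arXiv:1108.1335v2 TeX L3265–3268)] -/
theorem prod_one_add_sub_one_le {Q : Finset P} {w : P → ℝ} (hw : ∀ X ∈ Q, 0 ≤ w X) :
    ∏ X ∈ Q, (1 + w X) - 1 ≤ (∑ X ∈ Q, w X) * Real.exp (∑ X ∈ Q, w X) := by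
  set W := ∑ X ∈ Q, w X with hW
  have hW0 : 0 ≤ W := Finset.sum_nonneg hw
  have h1 : ∏ X ∈ Q, (1 + w X) ≤ Real.exp W := by
    rw [hW, Real.exp_sum]
    exact Finset.prod_le_prod (fun X hX => by linarith [hw X hX]) fun X _ => by
      have := Real.add_one_le_exp (w X); linarith
  -- `e^W − 1 ≤ W e^W` from `1 − W ≤ e^{−W}`
  have h2 : Real.exp W - 1 ≤ W * Real.exp W := by
    have h3 : (1 - W) * Real.exp W ≤ 1 := by
      have := Real.one_sub_le_exp_neg W
      calc (1 - W) * Real.exp W ≤ Real.exp (-W) * Real.exp W :=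
            mul_le_mul_of_nonneg_right this (Real.exp_pos _).le
        _ = 1 := by rw [← Real.exp_add]; simp
    nlinarith
  linarith

/-! ## §4 The assembled bound (L3262–3268) -/

/-- **`|K(Y)| ≤ e^{−(κ−κ₀)d_M(Y)} · e^{−c(κ−κ₀)} · W e^{W}`, `W = 2H₀e^{c(κ−κ₀)}Σ_{X∈Q}e^{−κ₀d(X)}`** — the four displayed
lines L3262–3268 for an abstract family `TS` of nonempty sub-collections `T ⊆ Q` each satisfying (clams), with
`|a(X)| ≤ 2H₀e^{−κd(X)}` on `Q`. [cite: Dimock2013, App. B Theorem cluster, proof step 1 (arXiv:1108.1335v2 TeX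
L3259–3270)] -/
theorem norm_clusterSum_le [DecidableEq P] {𝕜 : Type*} [NormedField 𝕜] {Q : Finset P} {TS : Finset (Finset P)}
    {a : P → 𝕜} {d : P → ℝ} {dY c κ κ₀ H₀ : ℝ} (hκ : κ₀ ≤ κ) (hH₀ : 0 ≤ H₀)
    (hTS : ∀ T ∈ TS, T ⊆ Q ∧ T.Nonempty) (hclams : ∀ T ∈ TS, dY ≤ ∑ X ∈ T, d X + c * (T.card - 1))
    (ha : ∀ X ∈ Q, ‖a X‖ ≤ 2 * H₀ * Real.exp (-κ * d X)) :
    ‖∑ T ∈ TS, ∏ X ∈ T, a X‖ ≤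
      Real.exp (-(κ - κ₀) * dY) * Real.exp (-(c * (κ - κ₀))) *
        ((∑ X ∈ Q, 2 * H₀ * Real.exp (c * (κ - κ₀)) * Real.exp (-κ₀ * d X)) *
          Real.exp (∑ X ∈ Q, 2 * H₀ * Real.exp (c * (κ - κ₀)) * Real.exp (-κ₀ * d X))) := by
  set w : P → ℝ := fun X => 2 * H₀ * Real.exp (c * (κ - κ₀)) * Real.exp (-κ₀ * d X) with hw
  have hw0 : ∀ X ∈ Q, 0 ≤ w X := fun X _ => by positivity
  have hE : 0 ≤ Real.exp (-(κ - κ₀) * dY) * Real.exp (-(c * (κ - κ₀))) := by positivity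
  -- termwise
  have hterm : ∀ T ∈ TS, ‖∏ X ∈ T, a X‖ ≤
      Real.exp (-(κ - κ₀) * dY) * Real.exp (-(c * (κ - κ₀))) * ∏ X ∈ T, w X := by
    intro T hT
    have hTQ := (hTS T hT).1
    calc ‖∏ X ∈ T, a X‖ ≤ ∏ X ∈ T, ‖a X‖ := Finset.norm_prod_le _ _
      _ ≤ ∏ X ∈ T, 2 * H₀ * Real.exp (-κ * d X) :=
          Finset.prod_le_prod (fun X _ => norm_nonneg _) fun X hX => ha X (hTQ hX)
      _ = (2 * H₀) ^ T.card * ∏ X ∈ T, Real.exp (-κ * d X) := by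
          rw [Finset.prod_mul_distrib, Finset.prod_const]
      _ ≤ (2 * H₀) ^ T.card * (Real.exp (-(κ - κ₀) * dY) * Real.exp (-(c * (κ - κ₀))) *
            ∏ X ∈ T, (Real.exp (c * (κ - κ₀)) * Real.exp (-κ₀ * d X))) :=
          mul_le_mul_of_nonneg_left (prod_exp_le_extract T hκ (hclams T hT)) (pow_nonneg (by linarith) _)
      _ = Real.exp (-(κ - κ₀) * dY) * Real.exp (-(c * (κ - κ₀))) * ∏ X ∈ T, w X := by
          rw [hw]
          simp only []
          rw [show (∏ X ∈ T, 2 * H₀ * Real.exp (c * (κ - κ₀)) * Real.exp (-κ₀ * d X)) =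
              (2 * H₀) ^ T.card * ∏ X ∈ T, (Real.exp (c * (κ - κ₀)) * Real.exp (-κ₀ * d X)) by
            rw [← Finset.prod_const, ← Finset.prod_mul_distrib]
            exact Finset.prod_congr rfl fun X _ => by ring]
          ring
  calc ‖∑ T ∈ TS, ∏ X ∈ T, a X‖ ≤ ∑ T ∈ TS, ‖∏ X ∈ T, a X‖ := norm_sum_le _ _
    _ ≤ ∑ T ∈ TS, Real.exp (-(κ - κ₀) * dY) * Real.exp (-(c * (κ - κ₀))) * ∏ X ∈ T, w X :=
        Finset.sum_le_sum hterm
    _ = Real.exp (-(κ - κ₀) * dY) * Real.exp (-(c * (κ - κ₀))) * ∑ T ∈ TS, ∏ X ∈ T, w X := by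
        rw [Finset.mul_sum]
    _ ≤ Real.exp (-(κ - κ₀) * dY) * Real.exp (-(c * (κ - κ₀))) * (∏ X ∈ Q, (1 + w X) - 1) :=
        mul_le_mul_of_nonneg_left (sum_prod_le_prod_one_add_sub_one hw0 hTS) hE
    _ ≤ Real.exp (-(κ - κ₀) * dY) * Real.exp (-(c * (κ - κ₀))) *
          ((∑ X ∈ Q, w X) * Real.exp (∑ X ∈ Q, w X)) :=
        mul_le_mul_of_nonneg_left (prod_one_add_sub_one_le hw0) hE

/-! ## §5 The closing arithmetic (L3271–3279) -/

/-- **`|K(Y,Φ)| ≤ 𝒪(1) H_0 e^{−(κ−κ_0−2)d_M(Y)}` WITH `𝒪(1) = 2eK₀κ₀`**: from §4 with (sudsy) `Σ_{X∈Q}e^{−κ₀d(X)} ≤ K₀|Y|_M`,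
(ninety) `|Y|_M ≤ κ₀(1 + d_M(Y))`, `H₀ ≤ c₀` and *"c_0 is small enough so that 2c_0K_0κ_0e^{κ−κ_0} ≤ 1"* (here
`e^{c(κ−κ₀)}`): then `W ≤ 1 + d_M(Y)` (*"the exponent is bounded by 𝒪(1)e^{d_M(Y)}"*) and `W ≤ 2K₀κ₀e^{c(κ−κ₀)}H₀e^{d_M(Y)}`
(*"downstairs … bounded by 𝒪(1)H_0e^{d_M(Y)}"*). [cite: Dimock2013, App. B Theorem cluster, proof step 1 (arXiv:1108.1335v2
TeX L3271–3279)] -/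
theorem norm_clusterSum_le_final [DecidableEq P] {𝕜 : Type*} [NormedField 𝕜] {Q : Finset P} {TS : Finset (Finset P)}
    {a : P → 𝕜} {d : P → ℝ} {dY vY c κ κ₀ H₀ c₀ K₀ : ℝ} (hκ : κ₀ ≤ κ) (hH₀ : 0 ≤ H₀) (hdY : 0 ≤ dY)
    (hK₀ : 0 ≤ K₀) (hκ₀ : 0 ≤ κ₀)
    (hTS : ∀ T ∈ TS, T ⊆ Q ∧ T.Nonempty) (hclams : ∀ T ∈ TS, dY ≤ ∑ X ∈ T, d X + c * (T.card - 1))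
    (ha : ∀ X ∈ Q, ‖a X‖ ≤ 2 * H₀ * Real.exp (-κ * d X))
    (hsudsy : ∑ X ∈ Q, Real.exp (-κ₀ * d X) ≤ K₀ * vY) (hninety : vY ≤ κ₀ * (1 + dY))
    (hc₀ : H₀ ≤ c₀) (hsmall : 2 * c₀ * K₀ * κ₀ * Real.exp (c * (κ - κ₀)) ≤ 1) :
    ‖∑ T ∈ TS, ∏ X ∈ T, a X‖ ≤ 2 * Real.exp 1 * K₀ * κ₀ * H₀ * Real.exp (-(κ - κ₀ - 2) * dY) := by
  have h := norm_clusterSum_le hκ hH₀ hTS hclams ha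
  set E := Real.exp (c * (κ - κ₀)) with hE
  set W := ∑ X ∈ Q, 2 * H₀ * E * Real.exp (-κ₀ * d X) with hW
  have hEpos : 0 < E := Real.exp_pos _
  -- W = 2H₀E Σ e^{-κ₀ d} ≤ 2H₀E K₀ vY ≤ 2H₀E K₀ κ₀ (1 + dY)
  have hWeq : W = 2 * H₀ * E * ∑ X ∈ Q, Real.exp (-κ₀ * d X) := by rw [hW, Finset.mul_sum]
  have hW1 : W ≤ 2 * H₀ * E * (K₀ * (κ₀ * (1 + dY))) := by
    rw [hWeq]
    refine mul_le_mul_of_nonneg_left (hsudsy.trans (mul_le_mul_of_nonneg_left hninety hK₀)) ?_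
    positivity
  -- the exponent: W ≤ 1 + dY
  have hW2 : W ≤ 1 + dY := by
    have : 2 * H₀ * E * (K₀ * (κ₀ * (1 + dY))) = (2 * H₀ * K₀ * κ₀ * E) * (1 + dY) := by ring
    rw [this] at hW1
    have hcoef : 2 * H₀ * K₀ * κ₀ * E ≤ 1 := by
      calc 2 * H₀ * K₀ * κ₀ * E ≤ 2 * c₀ * K₀ * κ₀ * E := by
            have : 0 ≤ 2 * K₀ * κ₀ * E := by positivity
            nlinarith
        _ ≤ 1 := hsmall
    calc W ≤ (2 * H₀ * K₀ * κ₀ * E) * (1 + dY) := hW1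
      _ ≤ 1 * (1 + dY) := mul_le_mul_of_nonneg_right hcoef (by linarith)
      _ = 1 + dY := one_mul _
  -- downstairs: W ≤ (2K₀κ₀E) H₀ e^{dY}
  have hW3 : W ≤ 2 * K₀ * κ₀ * E * H₀ * Real.exp dY := by
    have h1dY : 1 + dY ≤ Real.exp dY := by have := Real.add_one_le_exp dY; linarith
    calc W ≤ 2 * H₀ * E * (K₀ * (κ₀ * (1 + dY))) := hW1
      _ = (2 * K₀ * κ₀ * E * H₀) * (1 + dY) := by ring
      _ ≤ (2 * K₀ * κ₀ * E * H₀) * Real.exp dY := mul_le_mul_of_nonneg_left h1dY (by positivity)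
  have hW0 : 0 ≤ W := by rw [hWeq]; exact mul_nonneg (by positivity) (Finset.sum_nonneg fun X _ => (Real.exp_pos _).le)
  -- assemble
  have hWexp : W * Real.exp W ≤ (2 * K₀ * κ₀ * E * H₀ * Real.exp dY) * Real.exp (1 + dY) :=
    mul_le_mul hW3 (Real.exp_le_exp.2 hW2) (Real.exp_pos _).le (by positivity)
  calc ‖∑ T ∈ TS, ∏ X ∈ T, a X‖
      ≤ Real.exp (-(κ - κ₀) * dY) * Real.exp (-(c * (κ - κ₀))) * (W * Real.exp W) := h
    _ ≤ Real.exp (-(κ - κ₀) * dY) * Real.exp (-(c * (κ - κ₀))) *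
          ((2 * K₀ * κ₀ * E * H₀ * Real.exp dY) * Real.exp (1 + dY)) :=
        mul_le_mul_of_nonneg_left hWexp (by positivity)
    _ = 2 * Real.exp 1 * K₀ * κ₀ * H₀ * Real.exp (-(κ - κ₀ - 2) * dY) := by
        have hEE : Real.exp (-(c * (κ - κ₀))) * E = 1 := by
          rw [hE, ← Real.exp_add]; simp
        have hexps : Real.exp (-(κ - κ₀) * dY) * Real.exp dY * Real.exp (1 + dY) =
            Real.exp 1 * Real.exp (-(κ - κ₀ - 2) * dY) := by
          rw [← Real.exp_add, ← Real.exp_add, ← Real.exp_add]; ring_nf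
        calc Real.exp (-(κ - κ₀) * dY) * Real.exp (-(c * (κ - κ₀))) *
              ((2 * K₀ * κ₀ * E * H₀ * Real.exp dY) * Real.exp (1 + dY))
            = 2 * K₀ * κ₀ * H₀ * (Real.exp (-(c * (κ - κ₀))) * E) *
                (Real.exp (-(κ - κ₀) * dY) * Real.exp dY * Real.exp (1 + dY)) := by ring
          _ = 2 * Real.exp 1 * K₀ * κ₀ * H₀ * Real.exp (-(κ - κ₀ - 2) * dY) := by
                rw [hEE, hexps]; ring

/-! ## §6 (v1.1) The instance: Dimock's `K(Y)` over the connected covers of `Y` -/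

section Instance

open Literature.MathematicalPhysics.QuantumFieldTheory.Dimock2011to13.MayerExpansion (K covers mem_covers U)

variable [DecidableEq P] {C : Type*} [DecidableEq C]

omit [DecidableEq P] in
/-- the members of a connected cover of `Y` are polymers of `Pol` supported inside `Y`: `T ⊆ Q(Y) = {X ∈ Pol : X ⊆ Y}`, and
`T ≠ ∅`. [cite: Dimock2013, App. B Theorem cluster, proof step 1 (arXiv:1108.1335v2 TeX L3215–3219, L3244–3246)] -/
theorem covers_subset_inside {supp : P → Finset C} {Pol : Finset P} {Y : Finset C} {T : Finset P}
    (hT : T ∈ covers supp Pol Y) : T ⊆ Pol.filter (fun X => supp X ⊆ Y) ∧ T.Nonempty := by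
  obtain ⟨hTP, hconn, hU⟩ := mem_covers.1 hT
  refine ⟨fun X hX => Finset.mem_filter.2 ⟨hTP hX, ?_⟩, hconn.1⟩
  rw [← hU]
  exact Finset.subset_biUnion_of_mem supp hX

/-- **THE BOUND ON DIMOCK'S `K(Y,Φ)` ITSELF** (L3277–3279: *"|K(Y,Φ)| ≤ 𝒪(1) H_0 e^{−(κ−κ_0−2)d_M(Y)}"*): the abstract bound
`norm_clusterSum_le_final` instantiated with `TS =` the connected covers of `Y` (`MayerExpansion.covers supp Pol Y`, the index
set of `MayerExpansion.K`) and `Q = {X ∈ Pol : X ⊆ Y}`; the geometric inputs (clams) (per cover), (sudsy), (ninety) and the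
smallness `2c₀K₀κ₀e^{c(κ−κ₀)} ≤ 1` stay hypotheses. [cite: Dimock2013, App. B Theorem cluster, proof step 1 (arXiv:1108.1335v2
TeX L3234–3279)] -/
theorem norm_K_le {𝕜 : Type*} [NormedField 𝕜] {supp : P → Finset C} {Pol : Finset P} {Y : Finset C}
    {a : P → 𝕜} {d : P → ℝ} {dY vY c κ κ₀ H₀ c₀ K₀ : ℝ} (hκ : κ₀ ≤ κ) (hH₀ : 0 ≤ H₀) (hdY : 0 ≤ dY)
    (hK₀ : 0 ≤ K₀) (hκ₀ : 0 ≤ κ₀)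
    (hclams : ∀ T ∈ covers supp Pol Y, dY ≤ ∑ X ∈ T, d X + c * (T.card - 1))
    (ha : ∀ X ∈ Pol, supp X ⊆ Y → ‖a X‖ ≤ 2 * H₀ * Real.exp (-κ * d X))
    (hsudsy : ∑ X ∈ Pol.filter (fun X => supp X ⊆ Y), Real.exp (-κ₀ * d X) ≤ K₀ * vY) (hninety : vY ≤ κ₀ * (1 + dY))
    (hc₀ : H₀ ≤ c₀) (hsmall : 2 * c₀ * K₀ * κ₀ * Real.exp (c * (κ - κ₀)) ≤ 1) :
    ‖K supp Pol (fun T => ∏ X ∈ T, a X) Y‖ ≤ 2 * Real.exp 1 * K₀ * κ₀ * H₀ * Real.exp (-(κ - κ₀ - 2) * dY) := by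
  unfold K
  exact norm_clusterSum_le_final hκ hH₀ hdY hK₀ hκ₀ (fun T hT => covers_subset_inside hT) hclams
    (fun X hX => by
      obtain ⟨hXP, hXY⟩ := Finset.mem_filter.1 hX
      exact ha X hXP hXY) hsudsy hninety hc₀ hsmall

end Instance

end Literature.MathematicalPhysics.QuantumFieldTheory.Dimock2011to13.ClusterActivityBound

end
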